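import Literature.NumberTheory.NumberFields.CMFieldKummerGeneratorMinusPart
import Literature.NumberTheory.NumberFields.ClassGroupUnitsGaloisModules
import Literature.NumberTheory.NumberFields.IdealPowerOfUnramifiedRoot
import HarnessLib

/-!
# Route `PrintCFram`, crux C2 `BottomClassIndexLawFiveLe` (stmt-BirchSwinnertonDyer-20372), line
# `eisenstein-resource-bdp-line` v10, Stub H — the REFLECTION STEP as theorems, part 1: KUMMER EQUIVARIANCE.
# If an automorphism `g` of `K̄` stabilises a Kummer extension `M = K(β^{1/p})` of `K ∋ ζ_p`, acts on `ζ_p` by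
# `ζ ↦ ζ^a` and normalises `Gal(M/K)` through `τ g = g τ^m`, then `g β = β^{a m} · γ^p` with `γ ∈ K`
# (cell `bsd-print-cfram`, seat `bsd-line-cfram-p1-w8` g0; helper `--supports` 20372; 0 facts, 0 defs)

HONEST FRAMING. Nothing about BSD is proved here. This is the first of the «reflection as theorems» files announced in
`Cruxes/BottomClassIndexLawFiveLe/Lines/eisenstein-resource-bdp-line-w8g0-notes.md` §3 (R-K): the `χ`-by-`χ` bookkeeping of the
Kummer pairing which, in Leopoldt's reflection theorem (Washington §10.2) and in Gross's Lemma 22.3.4, turns «`Gal(M/K)` is a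
`χ`-eigenline under `Gal(K/ℚ)`» into «the Kummer radicand `β` is an `ωχ⁻¹`-eigenvector modulo `p`-th powers». The tree's
`IsCMField.mul_conjLift_mem_range` (`NumberFields/CMFieldKummerGeneratorMinusPart.lean`) is the case `g` = complex conjugation
(`a = −1`, `m = 1`: `β · ḡβ ∈ K^{×p}`); here `g` is ANY ring automorphism of `K̄` stabilising `M` (no base field needed).

* §1 `apply_pow_kummer_generator` — if `τα = ζ^i α` then `τ^m α = ζ^{im} α`;
  **`exists_apply_radicand_eq_pow_mul_pow`** — the statement of the title: `K` a number field with a primitive `p`-th root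
  of unity `ζ` (`p` prime), `M ⊆ K̄` finite Galois over `K`, `α ∈ M` with `α^p = β ∈ K`, `β ≠ 0`, `g : K̄ ≃+* K̄` with `g(M) ⊆ M`,
  `g ζ = ζ^a`, and `τ (g x) = g (τ^m x)` for all `τ ∈ Gal(M/K)`, `x ∈ M` ⟹ `∃ γ ∈ K, g β = β^{a m} γ^p`
  (`δ := gα / α^{am} ∈ M` is fixed by every `τ`: `τ(gα) = g(τ^m α) = g(ζ^{im} α) = ζ^{aim} gα`).
* §2 (ideals; `g|_K = σ` an automorphism of `K`) `map_intAut_eq_pow_mul_span` and **`classGroupRep_mk0_eq_smul_of_radicand`** — if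
  moreover `(β) = 𝔞^p` then `σ𝔞 = 𝔞^{am} · (γ)` and the class of `𝔞` is an eigenvector: `σ · [𝔞] = (a m) • [𝔞]` in
  `Additive (ClassGroup (𝓞 K))` (`classGroupRep ℚ K`), with `p • [𝔞] = 0`.

THEOREMS ONLY; no definition, no named fact, no `sorry`; imports no `Theses` module. BSD is not proved by any of this; no summit
statement is proved by this seat.
References: [Washington1997] §10.2 (proof of Thm. 10.9: the pairing `Gal × B → μ_p` is `G`-equivariant); [Lang1990] Ch. 13 §2
Thm. 2.1 (proof); [Gross1980] Lemma 22.3.4 (proof: "Kummer theory furnishes a `Gal(L/ℚ)` isomorphism `Gal(L(p)/L) = Hom(C, μ_p)`").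
-/

set_option autoImplicit false
-- `…BirchSwinnertonDyer.BirchSwinnertonDyer.Theorems…` is the problem's mandated namespace (D-0017).
set_option linter.dupNamespace false

noncomputable section

namespace Summit.BirchSwinnertonDyer.BirchSwinnertonDyer.Theorems.PrintCFram.HerbrandKummer

open Literature.NumberTheory.NumberFields NumberField IsDedekindDomain Module IntermediateField
open scoped nonZeroDivisors

/-! ## §1 The radicand of a normalised Kummer extension is an eigenvector modulo `p`-th powers -/

section Radicand

variable {K : Type} [Field K] [NumberField K]

/-- `x^p = z^p` with a primitive `p`-th root of unity `ζ` around forces `x = ζ^i z`. [folklore] -/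
theorem exists_eq_pow_mul_of_pow_eq {Ω : Type*} [Field Ω] {p : ℕ} (hp : 0 < p) {ζ x z : Ω}
    (hζ : IsPrimitiveRoot ζ p) (h : x ^ p = z ^ p) : ∃ i : ℕ, x = ζ ^ i * z := by
  by_cases hz : z = 0
  · refine ⟨0, ?_⟩
    rw [hz, zero_pow hp.ne'] at h
    rw [hz, mul_zero]
    exact pow_eq_zero_iff hp.ne' |>.mp h
  · haveI : NeZero p := ⟨hp.ne'⟩
    have h1 : (x / z) ^ p = 1 := by rw [div_pow, h, div_self (pow_ne_zero _ hz)]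
    obtain ⟨i, -, hi⟩ := hζ.eq_pow_of_pow_eq_one h1
    exact ⟨i, by rw [hi, div_mul_cancel₀ x hz]⟩

omit [NumberField K] in
/-- If `τ α = ζ^i α` for a `K`-automorphism `τ` of `M ⊇ K ∋ ζ`, then `τ^m α = ζ^{im} α`. [folklore] -/
theorem apply_pow_kummer_generator {M : IntermediateField K (AlgebraicClosure K)} (τ : M ≃ₐ[K] M)
    (ζ : K) (α : M) (i : ℕ) (hτ : τ α = algebraMap K M ζ ^ i * α) (m : ℕ) :
    (τ ^ m) α = algebraMap K M ζ ^ (i * m) * α := by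
  induction m with
  | zero => simp
  | succ m ih =>
    rw [pow_succ', AlgEquiv.mul_apply, ih, map_mul, map_pow, AlgEquiv.commutes, hτ, ← mul_assoc,
      ← pow_add, Nat.mul_succ]

/-- **Kummer equivariance.** Let `K` be a number field containing a primitive `p`-th root of unity `ζ` (`p` prime), `M ⊆ K̄`
finite Galois over `K`, `α ∈ M` with `α^p = β ∈ K`, `β ≠ 0`, and `g` a ring automorphism of `K̄` with `g(M) ⊆ M`,
`g ζ = ζ^a` and `τ (g x) = g (τ^m x)` for every `τ ∈ Gal(M/K)` and `x ∈ M` (i.e. `g⁻¹ τ g = τ^m` on `M`). Then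
**`g β = β^{a m} · γ^p` for some `γ ∈ K`** — the radicand is an eigenvector of `g` modulo `p`-th powers, with eigen-exponent
«(action on `μ_p`) × (inverse of the action on `Gal(M/K)`)», the `ωχ⁻¹` of the reflection theorem.
[cite: Washington1997, §10.2 (proof of Thm. 10.9)] [cite: Lang1990, Ch. 13 §2, Thm. 2.1 (proof)] -/
theorem exists_apply_radicand_eq_pow_mul_pow {p : ℕ} (hp : p.Prime) {ζ : K} (hζ : IsPrimitiveRoot ζ p)
    {M : IntermediateField K (AlgebraicClosure K)} [FiniteDimensional K M] [IsGalois K M]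
    (g : AlgebraicClosure K ≃+* AlgebraicClosure K) (hgM : ∀ x : AlgebraicClosure K, x ∈ M → g x ∈ M)
    {a : ℕ} (hga : g (algebraMap K (AlgebraicClosure K) ζ) = algebraMap K (AlgebraicClosure K) ζ ^ a)
    {m : ℕ} (hrel : ∀ (τ : M ≃ₐ[K] M) (x : M), ((τ ⟨g x, hgM x x.2⟩ : M) : AlgebraicClosure K) = g ((τ ^ m) x : M))
    {α : M} {β : K} (hβ : β ≠ 0) (hαβ : (α : AlgebraicClosure K) ^ p = algebraMap K (AlgebraicClosure K) β) :
    ∃ γ : K, g (algebraMap K (AlgebraicClosure K) β) =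
      algebraMap K (AlgebraicClosure K) β ^ (a * m) * algebraMap K (AlgebraicClosure K) γ ^ p := by
  have hζΩ : IsPrimitiveRoot (algebraMap K (AlgebraicClosure K) ζ) p :=
    hζ.map_of_injective (FaithfulSMul.algebraMap_injective K (AlgebraicClosure K))
  have hα0 : (α : AlgebraicClosure K) ≠ 0 := by
    intro h
    apply hβ
    have : algebraMap K (AlgebraicClosure K) β = 0 := by rw [← hαβ, h, zero_pow hp.ne_zero]
    exact (map_eq_zero _).1 this
  -- `δ = g α / α^{a m} ∈ M`
  have hgα : g α ∈ M := hgM α α.2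
  have hδM : g α * ((α : AlgebraicClosure K) ^ (a * m))⁻¹ ∈ M :=
    mul_mem hgα (inv_mem (pow_mem α.2 _))
  set δ : M := ⟨g α * ((α : AlgebraicClosure K) ^ (a * m))⁻¹, hδM⟩ with hδdef
  -- `δ` is fixed by `Gal(M/K)`
  have hfix : ∀ τ : M ≃ₐ[K] M, τ δ = δ := by
    intro τ
    let h : AlgebraicClosure K ≃ₐ[K] AlgebraicClosure K := τ.liftNormal (AlgebraicClosure K)
    have hh : ∀ y : M, ((τ y : M) : AlgebraicClosure K) = h y := fun y =>
      (AlgEquiv.liftNormal_commutes τ (AlgebraicClosure K) y).symm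
    -- `τ α = ζ^i α`
    have hτα : (h α) ^ p = (α : AlgebraicClosure K) ^ p := by
      rw [← map_pow, hαβ, AlgEquiv.commutes]
    obtain ⟨i, hi⟩ := exists_eq_pow_mul_of_pow_eq hp.pos hζΩ hτα
    have hταM : τ α = algebraMap K M ζ ^ i * α := by
      apply Subtype.ext
      rw [hh]
      change h α = (algebraMap K M ζ : AlgebraicClosure K) ^ i * (α : AlgebraicClosure K)
      rw [hi]
      rfl
    -- `τ (g α) = g (τ^m α) = ζ^{a i m} g α`
    have h1 : h (g α) = algebraMap K (AlgebraicClosure K) ζ ^ (a * (i * m)) * g α := by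
      rw [← hh ⟨g α, hgα⟩, hrel τ α, apply_pow_kummer_generator τ ζ α i hταM m]
      change g ((algebraMap K M ζ : AlgebraicClosure K) ^ (i * m) * (α : AlgebraicClosure K)) = _
      rw [map_mul, map_pow]
      change g (algebraMap K (AlgebraicClosure K) ζ) ^ (i * m) * g α = _
      rw [hga, ← pow_mul]
    -- `τ (α^{a m}) = ζ^{i a m} α^{a m}`
    have h2 : h ((α : AlgebraicClosure K) ^ (a * m)) =
        algebraMap K (AlgebraicClosure K) ζ ^ (a * (i * m)) * (α : AlgebraicClosure K) ^ (a * m) := by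
      rw [map_pow, hi, mul_pow, ← pow_mul]
      congr 2
      ring
    apply Subtype.ext
    rw [hh]
    change h (g α * ((α : AlgebraicClosure K) ^ (a * m))⁻¹) = g α * ((α : AlgebraicClosure K) ^ (a * m))⁻¹
    have hζ0 : algebraMap K (AlgebraicClosure K) ζ ^ (a * (i * m)) ≠ 0 := pow_ne_zero _ (hζΩ.ne_zero hp.ne_zero)
    rw [map_mul, map_inv₀, h1, h2, mul_inv, mul_mul_mul_comm, mul_inv_cancel₀ hζ0, one_mul]
  obtain ⟨γ, hγ⟩ := (IsGalois.mem_range_algebraMap_iff_fixed δ).mpr hfix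
  refine ⟨γ, ?_⟩
  have hγ' : algebraMap K (AlgebraicClosure K) γ = g α * ((α : AlgebraicClosure K) ^ (a * m))⁻¹ := by
    rw [IsScalarTower.algebraMap_apply K M (AlgebraicClosure K), hγ]
    rfl
  have hαam : (α : AlgebraicClosure K) ^ (a * m) ≠ 0 := pow_ne_zero _ hα0
  -- `g β = (g α)^p = (δ α^{am})^p = β^{am} γ^p`
  calc g (algebraMap K (AlgebraicClosure K) β)
      = (g α) ^ p := by rw [← hαβ, map_pow]
    _ = (algebraMap K (AlgebraicClosure K) γ * (α : AlgebraicClosure K) ^ (a * m)) ^ p := by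
        rw [hγ', inv_mul_cancel_right₀ hαam]
    _ = algebraMap K (AlgebraicClosure K) β ^ (a * m) * algebraMap K (AlgebraicClosure K) γ ^ p := by
        rw [mul_pow, ← pow_mul, mul_comm (a * m) p, pow_mul, hαβ, mul_comm]

end Radicand

/-! ## §2 Ideals: `(β) = 𝔞^p` and `g β = β^e γ^p` give `σ𝔞 = 𝔞^e (γ)`, so `[𝔞]` is an eigenvector -/

section Ideals

variable {K : Type} [Field K] [NumberField K]

/-- The ring automorphism `intAut σ` of `𝓞 K` maps `(x)` to `(σ x)`. [folklore] -/
theorem map_intAut_span_singleton (σ : K ≃ₐ[ℚ] K) (x : 𝓞 K) :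
    (Ideal.span {x}).map (AmbiguousClass.intAut σ : 𝓞 K →+* 𝓞 K) = Ideal.span {AmbiguousClass.intAut σ x} := by
  rw [Ideal.map_span, Set.image_singleton]
  rfl

/-- **The ideal `p`-th root of an eigen-radicand is an eigen-ideal.** If `(β) = 𝔞^p` in `𝓞 K`, `p ≠ 0`, and
`σ β = β^e γ^p` for an automorphism `σ` of `K` and `γ ∈ 𝓞 K`, then `σ 𝔞 = 𝔞^e · (γ)`.
[cite: Washington1997, §10.2 (proof of Thm. 10.9: "`(b) = 𝔟^p`" and the `G`-action)] [cite: Lang1990, Ch. 13 §2, Thm. 2.1 (proof: "`(b) = 𝔟^p` … `φ⁻`")] -/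
theorem map_intAut_eq_pow_mul_span {p : ℕ} (hp : p ≠ 0) (σ : K ≃ₐ[ℚ] K) {β γ : 𝓞 K} {𝔞 : Ideal (𝓞 K)}
    {e : ℕ} (h𝔞 : Ideal.span {β} = 𝔞 ^ p)
    (hσβ : AmbiguousClass.intAut σ β = β ^ e * γ ^ p) :
    𝔞.map (AmbiguousClass.intAut σ : 𝓞 K →+* 𝓞 K) = 𝔞 ^ e * Ideal.span {γ} := by
  classical
  -- unique extraction of `p`-th roots of ideals (the tree's `Liu2021.Def45.ideal_eq_of_pow_eq_pow`, inlined to keep imports light)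
  have hroot : ∀ {I J : Ideal (𝓞 K)}, I ^ p = J ^ p → I = J := by
    intro I J h
    have hzero : ∀ {I J : Ideal (𝓞 K)}, I ^ p = J ^ p → I = ⊥ → J = ⊥ := by
      intro I J h hI
      rw [hI, ← Ideal.zero_eq_bot, zero_pow hp] at h
      rw [← Ideal.zero_eq_bot]
      exact pow_eq_zero_iff hp |>.mp h.symm
    by_cases hI : I = ⊥
    · rw [hI, hzero h hI]
    have hJ : J ≠ ⊥ := fun hJ => hI (hzero h.symm hJ)
    have hf := congrArg UniqueFactorizationMonoid.normalizedFactors h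
    rw [UniqueFactorizationMonoid.normalizedFactors_pow,
      UniqueFactorizationMonoid.normalizedFactors_pow] at hf
    have hf' : UniqueFactorizationMonoid.normalizedFactors I =
        UniqueFactorizationMonoid.normalizedFactors J := by
      ext q
      have := congrArg (Multiset.count q) hf
      simp only [Multiset.count_nsmul] at this
      exact Nat.eq_of_mul_eq_mul_left (Nat.pos_of_ne_zero hp) this
    rw [← Ideal.prod_normalizedFactors_eq_self hI, ← Ideal.prod_normalizedFactors_eq_self hJ, hf']
  apply hroot
  rw [← Ideal.map_pow, ← h𝔞, map_intAut_span_singleton, hσβ, mul_pow, ← pow_mul, mul_comm e p, pow_mul, ← h𝔞,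
    Ideal.span_singleton_pow, Ideal.span_singleton_pow, Ideal.span_singleton_mul_span_singleton]

/-- **The class `[𝔞]` is an eigenvector: `σ · [𝔞] = e • [𝔞]` and `p • [𝔞] = 0`** in `Additive (ClassGroup (𝓞 K))` under
`classGroupRep ℚ K` (with `(β) = 𝔞^p`, `β ≠ 0`, `σβ = β^e γ^p`).
[cite: Washington1997, §10.2 (proof of Thm. 10.9)] [cite: Lang1990, Ch. 13 §2, Thm. 2.1 (proof)] -/
theorem classGroupRep_mk0_eq_smul_of_radicand {p : ℕ} (hp : p ≠ 0) (σ : K ≃ₐ[ℚ] K) {β γ : 𝓞 K} (hβ : β ≠ 0)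
    {𝔞 : Ideal (𝓞 K)} {e : ℕ} (h𝔞 : Ideal.span {β} = 𝔞 ^ p)
    (hσβ : AmbiguousClass.intAut σ β = β ^ e * γ ^ p) (h𝔞mem : 𝔞 ∈ (Ideal (𝓞 K))⁰) :
    classGroupRep ℚ K σ (Additive.ofMul (ClassGroup.mk0 ⟨𝔞, h𝔞mem⟩)) =
        e • Additive.ofMul (ClassGroup.mk0 ⟨𝔞, h𝔞mem⟩) ∧
      p • Additive.ofMul (ClassGroup.mk0 ⟨𝔞, h𝔞mem⟩) = 0 := by
  classical
  have hγ0 : γ ≠ 0 := by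
    intro hγ0
    rw [hγ0, zero_pow hp, mul_zero] at hσβ
    exact hβ ((map_eq_zero_iff _ (AmbiguousClass.intAut σ).injective).1 hσβ)
  constructor
  · -- `σ[𝔞] = [σ𝔞] = [𝔞^e (γ)] = e•[𝔞]`
    have hmap := map_intAut_eq_pow_mul_span hp σ h𝔞 hσβ
    have hγmem : Ideal.span {γ} ∈ (Ideal (𝓞 K))⁰ := by
      refine mem_nonZeroDivisors_of_ne_zero ?_
      rw [Ne, Submodule.zero_eq_bot, Ideal.span_singleton_eq_bot]; exact hγ0
    rw [classGroupRep_apply, AmbiguousClass.mulEquiv_mk0 σ ⟨𝔞, h𝔞mem⟩]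
    have h1 : (⟨_, AmbiguousClass.map_mem_nonZeroDivisors σ ⟨𝔞, h𝔞mem⟩⟩ : (Ideal (𝓞 K))⁰) =
        ⟨𝔞, h𝔞mem⟩ ^ e * ⟨Ideal.span {γ}, hγmem⟩ := by
      apply Subtype.ext
      simp only [Submonoid.coe_mul, SubmonoidClass.coe_pow]
      exact hmap
    have h2 : ClassGroup.mk0 ⟨Ideal.span {γ}, hγmem⟩ = 1 := (ClassGroup.mk0_eq_one_iff hγmem).mpr ⟨⟨γ, rfl⟩⟩
    rw [h1, map_mul, map_pow, h2, mul_one, ofMul_pow]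
  · -- `[𝔞]^p = [(β)] = 1`
    have hβmem : Ideal.span {β} ∈ (Ideal (𝓞 K))⁰ := by
      refine mem_nonZeroDivisors_of_ne_zero ?_
      rw [Ne, Submodule.zero_eq_bot, Ideal.span_singleton_eq_bot]; exact hβ
    have h3 : ClassGroup.mk0 (⟨𝔞, h𝔞mem⟩ ^ p) = ClassGroup.mk0 ⟨Ideal.span {β}, hβmem⟩ := by
      congr 1
      exact Subtype.ext h𝔞.symm
    rw [← ofMul_pow, ← map_pow, h3, (ClassGroup.mk0_eq_one_iff hβmem).mpr ⟨⟨β, rfl⟩⟩, ofMul_one]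

end Ideals

end Summit.BirchSwinnertonDyer.BirchSwinnertonDyer.Theorems.PrintCFram.HerbrandKummer

end
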